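import Mathlib
import Summits.QuantumFields.YangMills.Theses.MagneticFluxCeiling
import Summits.QuantumFields.YangMills.Theorems.MagneticFluxCeilingAbelianWitnessSpread
import Literature.MathematicalPhysics.QuantumFieldTheory.AnisotropicTwistedPartitionFunction
import Literature.MathematicalPhysics.QuantumFieldTheory.StrongCouplingActivities
import Literature.MathematicalPhysics.QuantumLattice.GaugeGroups
import HarnessLib

/-!
# The U(1) Coulomb-ceiling witness (aside item stmt-QuantumFields-26660 of route `MagneticFluxCeiling`, by name)

`AbelianCoulombWitness`: for the compact abelian Wilson theory (`G = Circle`, `ρ = u1Rep`), every `β ≥ 0`, every `θ`, every box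
`L_s³ × L_t` (`L_s, L_t ≥ 1`) and every SPATIAL plane `q`:
`−(βθ²/2)·L_t/L_s ≤ log Z(e^{iθ}) − log Z(1)`, `Z(z) = twistedPartitionFunctionAniso u1Rep β L_s L_t z q`.

Proof (the planner's WITNESS-PLAN-26660): (1) a link-wise Haar translation `U_ℓ ↦ λ_ℓ U_ℓ` (measure preserving; abelian, so
the plaquette holonomy picks up the coboundary `δλ`) with an explicit `λ` on the `i`- and `j`-links of the twisted plane `q = (i, j)`
SPREADS the point twist `e^{iθ}` on the stack `{x_i = 0 = x_j}` to the uniform phase `e^{iθ/L_s²}` on every `q`-plaquette;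
(2) the tangent-line form of Jensen, `e^{y} ≥ e^{a}(1 + y − a)`, against the untwisted Gibbs weight; (3) `⟨Im U_p⟩ = 0` by the
link-wise inversion `U ↦ U⁻¹` (Haar is inversion invariant; the Wilson weight is even) and `1 − cos ε ≤ ε²/2`:
`log Z(e^{iθ}) − log Z(1) ≥ −β·L_s³L_t·(1 − cos(θ/L_s²)) ≥ −(βθ²/2)·L_t/L_s`.
No summit is proved: a finite-box inequality for the abelian sibling; the Yang–Mills mass gap is NOT proved.
-/

noncomputable section

open MeasureTheory Filter Topology Function
open Literature.MathematicalPhysics.QuantumFieldTheory Literature.MathematicalPhysics.QuantumLattice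

namespace Summit.QuantumFields.YangMills.Theorems.MagneticFluxCeiling.AbelianWitness

/-! ### The abelian Wilson integral with a plaquette cochain -/

section Partition

variable [MeasurableSpace Circle] [BorelSpace Circle] {Ls Lt : ℕ}

omit [MeasurableSpace Circle] [BorelSpace Circle] in
/-- `Re tr u1Rep(g) = Re g`. [problem-side] -/
theorem trace_u1Rep_re (g : Circle) : (u1Rep g).trace.re = ((g : ℂ)).re := by
  simp [u1Rep_apply, Matrix.trace, Matrix.scalar_apply]

/-- The Wilson exponent of the box `L_s³ × L_t` for `G = U(1)` with a plaquette cochain `c` inserted: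
`S_c(U) = Σ_x Σ_{q'} (1 − Re(c(x,q')·U_{x,q'}))`. [problem-side] -/
def actionC (c : FinTorusSite Ls Ls Ls Lt → {p : Fin 4 × Fin 4 // p.1 < p.2} → Circle)
    (U : FinTorusSite Ls Ls Ls Lt × Fin 4 → Circle) : ℝ :=
  ∑ x : FinTorusSite Ls Ls Ls Lt, ∑ q' : {p : Fin 4 × Fin 4 // p.1 < p.2},
    (1 - (((c x q' * finTorusPlaquette U x q'.1.1 q'.1.2 : Circle) : ℂ)).re)

/-- The Wilson integral with the cochain `c`: `Z_c = ∫ e^{−β S_c(U)} ∏ dU`. [problem-side] -/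
def ZC (β : ℝ) (c : FinTorusSite Ls Ls Ls Lt → {p : Fin 4 × Fin 4 // p.1 < p.2} → Circle) : ℝ :=
  ∫ U, Real.exp (-β * actionC c U) ∂(Measure.pi fun _ : FinTorusSite Ls Ls Ls Lt × Fin 4 => haarProbability Circle)

/-- 't Hooft's single-plane stack cochain: `z` on the `q`-plaquettes with `x_i = 0 = x_j`, `1` elsewhere. [problem-side] -/
def stackC (z : Circle) (q : {p : Fin 4 × Fin 4 // p.1 < p.2}) (x : FinTorusSite Ls Ls Ls Lt)
    (q' : {p : Fin 4 × Fin 4 // p.1 < p.2}) : Circle :=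
  if q' = q ∧ finTorusSiteCoord x q.1.1 = 0 ∧ finTorusSiteCoord x q.1.2 = 0 then z else 1

/-- The uniform cochain: `w` on every `q`-plaquette, `1` elsewhere. [problem-side] -/
def unifC (w : Circle) (q : {p : Fin 4 × Fin 4 // p.1 < p.2}) (_x : FinTorusSite Ls Ls Ls Lt)
    (q' : {p : Fin 4 × Fin 4 // p.1 < p.2}) : Circle :=
  if q' = q then w else 1

/-- **The anisotropic twisted partition function of `U(1)` is `Z_c` for the stack cochain.** [problem-side] -/
theorem twistedPartitionFunctionAniso_u1_eq (β : ℝ) (z : Circle) (q : {p : Fin 4 × Fin 4 // p.1 < p.2}) :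
    twistedPartitionFunctionAniso u1Rep β Ls Lt z q = ZC β (stackC (Ls := Ls) (Lt := Lt) z q) := by
  rw [twistedPartitionFunctionAniso_eq_integral]
  unfold ZC actionC stackC
  refine integral_congr_ae (ae_of_all _ fun U => ?_)
  simp only [Nat.cast_one, trace_u1Rep_re]

omit [MeasurableSpace Circle] [BorelSpace Circle] in
/-- The plaquette holonomy is continuous in the configuration. [problem-side] -/
theorem continuous_finTorusPlaquette (x : FinTorusSite Ls Ls Ls Lt) (μ ν : Fin 4) :
    Continuous fun U : FinTorusSite Ls Ls Ls Lt × Fin 4 → Circle => finTorusPlaquette U x μ ν := by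
  unfold finTorusPlaquette
  fun_prop

omit [MeasurableSpace Circle] [BorelSpace Circle] in
/-- The Wilson exponent is continuous in the configuration. [problem-side] -/
theorem continuous_actionC (c : FinTorusSite Ls Ls Ls Lt → {p : Fin 4 × Fin 4 // p.1 < p.2} → Circle) :
    Continuous fun U : FinTorusSite Ls Ls Ls Lt × Fin 4 → Circle => actionC c U := by
  unfold actionC
  refine continuous_finsetSum _ fun x _ => continuous_finsetSum _ fun q' _ => continuous_const.sub ?_
  exact Complex.continuous_re.comp (continuous_subtype_val.comp (continuous_const.mul (continuous_finTorusPlaquette x _ _)))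

/-- A continuous real function on the (compact) configuration space is integrable. [problem-side] -/
theorem integrable_of_continuous {F : (FinTorusSite Ls Ls Ls Lt × Fin 4 → Circle) → ℝ} (hF : Continuous F) :
    Integrable F (Measure.pi fun _ : FinTorusSite Ls Ls Ls Lt × Fin 4 => haarProbability Circle) :=
  hF.integrable_of_hasCompactSupport
    (IsCompact.of_isClosed_subset isCompact_univ (isClosed_tsupport _) (Set.subset_univ _))

/-- `Z_c > 0`. [problem-side] -/
theorem ZC_pos (β : ℝ) (c : FinTorusSite Ls Ls Ls Lt → {p : Fin 4 × Fin 4 // p.1 < p.2} → Circle) : 0 < ZC β c := by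
  unfold ZC
  exact integral_exp_pos (integrable_of_continuous (Real.continuous_exp.comp (continuous_const.mul (continuous_actionC c))))

/-- **Coboundary invariance**: translating every link by `λ` is measure preserving, so `Z_c = Z_{c·δλ}`. [problem-side] -/
theorem ZC_eq_ZC_mul_cob (β : ℝ) (c : FinTorusSite Ls Ls Ls Lt → {p : Fin 4 × Fin 4 // p.1 < p.2} → Circle)
    (lam : FinTorusSite Ls Ls Ls Lt × Fin 4 → Circle) :
    ZC β c = ZC β (fun x q' => c x q' * cob lam x q'.1.1 q'.1.2) := by
  set μH : Measure (FinTorusSite Ls Ls Ls Lt × Fin 4 → Circle) :=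
    Measure.pi fun _ : FinTorusSite Ls Ls Ls Lt × Fin 4 => haarProbability Circle with hμH
  have hT : MeasurePreserving (fun (U : FinTorusSite Ls Ls Ls Lt × Fin 4 → Circle) l => lam l * U l) μH μH :=
    measurePreserving_pi (f := fun (l : FinTorusSite Ls Ls Ls Lt × Fin 4) (g : Circle) => lam l * g)
      (fun _ => haarProbability Circle) (fun _ => haarProbability Circle)
      fun l => measurePreserving_mul_left (haarProbability Circle) (lam l)
  have hF : Continuous fun U : FinTorusSite Ls Ls Ls Lt × Fin 4 → Circle => Real.exp (-β * actionC c U) :=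
    Real.continuous_exp.comp (continuous_const.mul (continuous_actionC c))
  have h := integral_map hT.measurable.aemeasurable (hF.aestronglyMeasurable (μ := Measure.map _ μH))
  rw [hT.map_eq] at h
  unfold ZC
  rw [h]
  refine integral_congr_ae (ae_of_all _ fun U => ?_)
  simp only [actionC, finTorusPlaquette_mul, mul_assoc]

/-- **Spreading the twist**: `Z(e^{iθ}) = Z_{c_w}` with the uniform cochain `c_w = e^{iθ/L_s²}` on every `q`-plaquette
(spatial plane, `L_s ≥ 1`). [problem-side] -/
theorem twistedPartitionFunctionAniso_u1_eq_unif (β θ : ℝ) (hLs : 1 ≤ Ls) (q : {p : Fin 4 × Fin 4 // p.1 < p.2})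
    (hq : q.1.2 ≠ 3) :
    twistedPartitionFunctionAniso u1Rep β Ls Lt (Circle.exp θ) q =
      ZC β (unifC (Ls := Ls) (Lt := Lt) (Circle.exp (θ / ((Ls : ℝ) ^ 2))) q) := by
  rw [twistedPartitionFunctionAniso_u1_eq, ZC_eq_ZC_mul_cob β _ (spread θ q)]
  congr 1
  funext x q'
  exact stack_mul_cob_spread θ hLs q hq x q'

/-- No twist: `Z(1) = Z_{c_1}`. [problem-side] -/
theorem twistedPartitionFunctionAniso_u1_one_eq_unif (β : ℝ) (q : {p : Fin 4 × Fin 4 // p.1 < p.2}) :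
    twistedPartitionFunctionAniso u1Rep β Ls Lt 1 q = ZC β (unifC (Ls := Ls) (Lt := Lt) 1 q) := by
  rw [twistedPartitionFunctionAniso_u1_eq]
  congr 1
  funext x q'
  simp [stackC, unifC]

end Partition

/-! ### Jensen (tangent-line form) against the untwisted Gibbs weight, and the inversion symmetry -/

section Jensen

variable [MeasurableSpace Circle] [BorelSpace Circle] {Ls Lt : ℕ}

/-- The untwisted Wilson exponent `S(U) = Σ_x Σ_{q'} (1 − Re U_{x,q'})`. [problem-side] -/
def action₁ (U : FinTorusSite Ls Ls Ls Lt × Fin 4 → Circle) : ℝ :=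
  ∑ x : FinTorusSite Ls Ls Ls Lt, ∑ q' : {p : Fin 4 × Fin 4 // p.1 < p.2},
    (1 - (((finTorusPlaquette U x q'.1.1 q'.1.2 : Circle) : ℂ)).re)

/-- The total real part of the `q`-plaquettes, `R(U) = Σ_x Re U_{x,q}`. [problem-side] -/
def reSum (q : {p : Fin 4 × Fin 4 // p.1 < p.2}) (U : FinTorusSite Ls Ls Ls Lt × Fin 4 → Circle) : ℝ :=
  ∑ x : FinTorusSite Ls Ls Ls Lt, (((finTorusPlaquette U x q.1.1 q.1.2 : Circle) : ℂ)).re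

/-- The total imaginary part of the `q`-plaquettes, `J(U) = Σ_x Im U_{x,q}`. [problem-side] -/
def imSum (q : {p : Fin 4 × Fin 4 // p.1 < p.2}) (U : FinTorusSite Ls Ls Ls Lt × Fin 4 → Circle) : ℝ :=
  ∑ x : FinTorusSite Ls Ls Ls Lt, (((finTorusPlaquette U x q.1.1 q.1.2 : Circle) : ℂ)).im

omit [MeasurableSpace Circle] [BorelSpace Circle] in
/-- The uniform cochain shifts the exponent by `D = (1 − Re w)·R + Im w·J`. [problem-side] -/
theorem actionC_unifC (w : Circle) (q : {p : Fin 4 × Fin 4 // p.1 < p.2}) (U : FinTorusSite Ls Ls Ls Lt × Fin 4 → Circle) :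
    actionC (unifC w q) U = action₁ U + ((1 - ((w : ℂ)).re) * reSum q U + ((w : ℂ)).im * imSum q U) := by
  unfold actionC action₁ reSum imSum unifC
  rw [Finset.mul_sum, Finset.mul_sum, ← Finset.sum_add_distrib, ← Finset.sum_add_distrib]
  refine Finset.sum_congr rfl fun x _ => ?_
  have hsplit : ∀ q' : {p : Fin 4 × Fin 4 // p.1 < p.2},
      (1 - ((((if q' = q then w else 1) * finTorusPlaquette U x q'.1.1 q'.1.2 : Circle) : ℂ)).re) =
        (1 - (((finTorusPlaquette U x q'.1.1 q'.1.2 : Circle) : ℂ)).re) +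
          (if q' = q then ((1 - ((w : ℂ)).re) * (((finTorusPlaquette U x q.1.1 q.1.2 : Circle) : ℂ)).re +
            ((w : ℂ)).im * (((finTorusPlaquette U x q.1.1 q.1.2 : Circle) : ℂ)).im) else 0) := by
    intro q'
    by_cases h : q' = q
    · subst h
      simp only [if_true, Circle.coe_mul, Complex.mul_re]
      ring
    · simp [h]
  simp_rw [hsplit]
  rw [Finset.sum_add_distrib, Finset.sum_ite_eq' Finset.univ q]
  simp

omit [MeasurableSpace Circle] [BorelSpace Circle] in
/-- The untwisted exponent at `w = 1`. [problem-side] -/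
theorem actionC_unifC_one (q : {p : Fin 4 × Fin 4 // p.1 < p.2}) (U : FinTorusSite Ls Ls Ls Lt × Fin 4 → Circle) :
    actionC (unifC 1 q) U = action₁ U := by
  rw [actionC_unifC]; simp

omit [MeasurableSpace Circle] [BorelSpace Circle] in
/-- Continuity of the untwisted exponent. [problem-side] -/
theorem continuous_action₁ : Continuous fun U : FinTorusSite Ls Ls Ls Lt × Fin 4 → Circle => action₁ U := by
  have h := continuous_actionC (Ls := Ls) (Lt := Lt) (unifC 1 ⟨((0 : Fin 4), (1 : Fin 4)), by decide⟩)
  simp only [actionC_unifC_one] at h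
  exact h

omit [MeasurableSpace Circle] [BorelSpace Circle] in
/-- Continuity of `R`. [problem-side] -/
theorem continuous_reSum (q : {p : Fin 4 × Fin 4 // p.1 < p.2}) :
    Continuous fun U : FinTorusSite Ls Ls Ls Lt × Fin 4 → Circle => reSum q U :=
  continuous_finsetSum _ fun x _ =>
    Complex.continuous_re.comp (continuous_subtype_val.comp (continuous_finTorusPlaquette x _ _))

omit [MeasurableSpace Circle] [BorelSpace Circle] in
/-- Continuity of `J`. [problem-side] -/
theorem continuous_imSum (q : {p : Fin 4 × Fin 4 // p.1 < p.2}) :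
    Continuous fun U : FinTorusSite Ls Ls Ls Lt × Fin 4 → Circle => imSum q U :=
  continuous_finsetSum _ fun x _ =>
    Complex.continuous_im.comp (continuous_subtype_val.comp (continuous_finTorusPlaquette x _ _))

omit [MeasurableSpace Circle] [BorelSpace Circle] in
/-- `R ≤ #sites` (each `Re U_p ≤ 1`). [problem-side] -/
theorem reSum_le (q : {p : Fin 4 × Fin 4 // p.1 < p.2}) (U : FinTorusSite Ls Ls Ls Lt × Fin 4 → Circle) :
    reSum q U ≤ Fintype.card (FinTorusSite Ls Ls Ls Lt) := by
  unfold reSum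
  calc ∑ x : FinTorusSite Ls Ls Ls Lt, (((finTorusPlaquette U x q.1.1 q.1.2 : Circle) : ℂ)).re
      ≤ ∑ _x : FinTorusSite Ls Ls Ls Lt, (1 : ℝ) := Finset.sum_le_sum fun x _ =>
        (Complex.re_le_norm _).trans (le_of_eq (Circle.norm_coe _))
    _ = Fintype.card (FinTorusSite Ls Ls Ls Lt) := by simp

/-- **Inversion symmetry**: `∫ e^{−βS} J = 0` (link-wise inversion preserves the product Haar measure and `S`, and flips `J`).
[problem-side] -/
theorem integral_exp_action₁_mul_imSum (β : ℝ) (q : {p : Fin 4 × Fin 4 // p.1 < p.2}) :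
    ∫ U, Real.exp (-β * action₁ U) * imSum (Ls := Ls) (Lt := Lt) q U
      ∂(Measure.pi fun _ : FinTorusSite Ls Ls Ls Lt × Fin 4 => haarProbability Circle) = 0 := by
  set μH : Measure (FinTorusSite Ls Ls Ls Lt × Fin 4 → Circle) :=
    Measure.pi fun _ : FinTorusSite Ls Ls Ls Lt × Fin 4 => haarProbability Circle with hμH
  have hT : MeasurePreserving (fun (U : FinTorusSite Ls Ls Ls Lt × Fin 4 → Circle) l => (U l)⁻¹) μH μH :=
    measurePreserving_pi (f := fun (_ : FinTorusSite Ls Ls Ls Lt × Fin 4) (g : Circle) => g⁻¹)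
      (fun _ => haarProbability Circle) (fun _ => haarProbability Circle)
      fun _ => Measure.measurePreserving_inv (haarProbability Circle)
  have hF : Continuous fun U : FinTorusSite Ls Ls Ls Lt × Fin 4 → Circle => Real.exp (-β * action₁ U) * imSum q U :=
    (Real.continuous_exp.comp (continuous_const.mul continuous_action₁)).mul (continuous_imSum q)
  have h := integral_map hT.measurable.aemeasurable (hF.aestronglyMeasurable (μ := Measure.map _ μH))
  rw [hT.map_eq] at h
  -- under inversion `S` is even and `J` is odd
  have hS : ∀ U : FinTorusSite Ls Ls Ls Lt × Fin 4 → Circle, action₁ (fun l => (U l)⁻¹) = action₁ U := fun U => by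
    unfold action₁
    simp only [finTorusPlaquette_inv, Circle.coe_inv_eq_conj, Complex.conj_re]
  have hJ : ∀ U : FinTorusSite Ls Ls Ls Lt × Fin 4 → Circle, imSum q (fun l => (U l)⁻¹) = -imSum q U := fun U => by
    unfold imSum
    simp only [finTorusPlaquette_inv, Circle.coe_inv_eq_conj, Complex.conj_im, Finset.sum_neg_distrib]
  simp only [hS, hJ, mul_neg, integral_neg] at h
  linarith

/-- **Tangent-line Jensen against the Gibbs weight**: `log Z_{c_w} − log Z_{c_1} ≥ −β·(1 − Re w)·#sites` (`β ≥ 0`). [problem-side] -/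
theorem log_ZC_unifC_sub_ge {β : ℝ} (hβ : 0 ≤ β) (w : Circle) (q : {p : Fin 4 × Fin 4 // p.1 < p.2}) :
    -(β * (1 - ((w : ℂ)).re) * Fintype.card (FinTorusSite Ls Ls Ls Lt)) ≤
      Real.log (ZC β (unifC (Ls := Ls) (Lt := Lt) w q)) - Real.log (ZC β (unifC (Ls := Ls) (Lt := Lt) 1 q)) := by
  set μH : Measure (FinTorusSite Ls Ls Ls Lt × Fin 4 → Circle) :=
    Measure.pi fun _ : FinTorusSite Ls Ls Ls Lt × Fin 4 => haarProbability Circle with hμH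
  set N : ℝ := (Fintype.card (FinTorusSite Ls Ls Ls Lt) : ℝ) with hN
  set a₀ : ℝ := -(β * (1 - ((w : ℂ)).re) * N) with ha₀
  have hw1 : 0 ≤ 1 - ((w : ℂ)).re := by
    have := (Complex.re_le_norm (w : ℂ)).trans (le_of_eq (Circle.norm_coe w))
    linarith
  -- the two partition functions as Gibbs integrals
  have hZ1 : ZC β (unifC (Ls := Ls) (Lt := Lt) 1 q) = ∫ U, Real.exp (-β * action₁ U) ∂μH := by
    unfold ZC; simp only [actionC_unifC_one]; rfl
  have hZw : ZC β (unifC (Ls := Ls) (Lt := Lt) w q) =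
      ∫ U, Real.exp (-β * action₁ U) * Real.exp (-β * ((1 - ((w : ℂ)).re) * reSum q U + ((w : ℂ)).im * imSum q U)) ∂μH := by
    unfold ZC
    refine integral_congr_ae (ae_of_all _ fun U => ?_)
    simp only [actionC_unifC, mul_add, ← Real.exp_add]
  have hZ1pos : 0 < ZC β (unifC (Ls := Ls) (Lt := Lt) 1 q) := ZC_pos β _
  have hZwpos : 0 < ZC β (unifC (Ls := Ls) (Lt := Lt) w q) := ZC_pos β _
  -- continuity / integrability
  have hcS : Continuous fun U : FinTorusSite Ls Ls Ls Lt × Fin 4 → Circle => Real.exp (-β * action₁ U) :=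
    Real.continuous_exp.comp (continuous_const.mul continuous_action₁)
  have hcD : Continuous fun U : FinTorusSite Ls Ls Ls Lt × Fin 4 → Circle =>
      (1 - ((w : ℂ)).re) * reSum q U + ((w : ℂ)).im * imSum q U :=
    (continuous_const.mul (continuous_reSum q)).add (continuous_const.mul (continuous_imSum q))
  -- tangent line: `e^{y} ≥ e^{a₀} (1 + y − a₀)` with `y = −βD`
  have htan : ∀ U : FinTorusSite Ls Ls Ls Lt × Fin 4 → Circle,
      Real.exp (-β * action₁ U) * (Real.exp a₀ * (1 + (-β * ((1 - ((w : ℂ)).re) * reSum q U + ((w : ℂ)).im * imSum q U) - a₀))) ≤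
        Real.exp (-β * action₁ U) * Real.exp (-β * ((1 - ((w : ℂ)).re) * reSum q U + ((w : ℂ)).im * imSum q U)) := by
    intro U
    refine mul_le_mul_of_nonneg_left ?_ (Real.exp_nonneg _)
    have h := Real.add_one_le_exp (-β * ((1 - ((w : ℂ)).re) * reSum q U + ((w : ℂ)).im * imSum q U) - a₀)
    calc Real.exp a₀ * (1 + (-β * ((1 - ((w : ℂ)).re) * reSum q U + ((w : ℂ)).im * imSum q U) - a₀))
        ≤ Real.exp a₀ * Real.exp (-β * ((1 - ((w : ℂ)).re) * reSum q U + ((w : ℂ)).im * imSum q U) - a₀) :=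
          mul_le_mul_of_nonneg_left (by linarith) (Real.exp_nonneg _)
      _ = _ := by rw [← Real.exp_add]; ring_nf
  -- integrate the tangent line
  have hint_lhs : Integrable (fun U : FinTorusSite Ls Ls Ls Lt × Fin 4 → Circle =>
      Real.exp (-β * action₁ U) * (Real.exp a₀ * (1 + (-β * ((1 - ((w : ℂ)).re) * reSum q U + ((w : ℂ)).im * imSum q U) - a₀)))) μH :=
    integrable_of_continuous (hcS.mul (continuous_const.mul ((continuous_const.add ((continuous_const.mul hcD).sub continuous_const)))))
  have hint_rhs : Integrable (fun U : FinTorusSite Ls Ls Ls Lt × Fin 4 → Circle =>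
      Real.exp (-β * action₁ U) * Real.exp (-β * ((1 - ((w : ℂ)).re) * reSum q U + ((w : ℂ)).im * imSum q U))) μH :=
    integrable_of_continuous (hcS.mul (Real.continuous_exp.comp (continuous_const.mul hcD)))
  have hmono := integral_mono hint_lhs hint_rhs htan
  -- evaluate the left side: `e^{a₀} [ (1 − a₀) Z₁ − β(1 − Re w) ∫ e^{−βS} R − β Im w ∫ e^{−βS} J ]`
  have hR := integral_exp_action₁_mul_imSum (Ls := Ls) (Lt := Lt) β q
  have hintS : Integrable (fun U : FinTorusSite Ls Ls Ls Lt × Fin 4 → Circle => Real.exp (-β * action₁ U)) μH :=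
    integrable_of_continuous hcS
  have hintSR : Integrable (fun U : FinTorusSite Ls Ls Ls Lt × Fin 4 → Circle => Real.exp (-β * action₁ U) * reSum q U) μH :=
    integrable_of_continuous (hcS.mul (continuous_reSum q))
  have hintSJ : Integrable (fun U : FinTorusSite Ls Ls Ls Lt × Fin 4 → Circle => Real.exp (-β * action₁ U) * imSum q U) μH :=
    integrable_of_continuous (hcS.mul (continuous_imSum q))
  have hlhs : ∫ U, Real.exp (-β * action₁ U) *
        (Real.exp a₀ * (1 + (-β * ((1 - ((w : ℂ)).re) * reSum q U + ((w : ℂ)).im * imSum q U) - a₀))) ∂μH =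
      Real.exp a₀ * ((1 - a₀) * (∫ U, Real.exp (-β * action₁ U) ∂μH) -
        β * (1 - ((w : ℂ)).re) * (∫ U, Real.exp (-β * action₁ U) * reSum q U ∂μH) -
        β * ((w : ℂ)).im * (∫ U, Real.exp (-β * action₁ U) * imSum q U ∂μH)) := by
    have hpt : ∀ U : FinTorusSite Ls Ls Ls Lt × Fin 4 → Circle, Real.exp (-β * action₁ U) *
        (Real.exp a₀ * (1 + (-β * ((1 - ((w : ℂ)).re) * reSum q U + ((w : ℂ)).im * imSum q U) - a₀))) =
        Real.exp a₀ * ((1 - a₀) * Real.exp (-β * action₁ U) -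
          β * (1 - ((w : ℂ)).re) * (Real.exp (-β * action₁ U) * reSum q U) -
          β * ((w : ℂ)).im * (Real.exp (-β * action₁ U) * imSum q U)) := fun U => by ring
    simp_rw [hpt]
    rw [integral_const_mul, integral_sub, integral_sub, integral_const_mul, integral_const_mul, integral_const_mul]
    · exact hintS.const_mul _
    · exact hintSR.const_mul _
    · exact (hintS.const_mul _).sub (hintSR.const_mul _)
    · exact hintSJ.const_mul _
  -- the mean of `R` under the Gibbs weight is at most `#sites · Z₁`
  have hRle : ∫ U, Real.exp (-β * action₁ U) * reSum q U ∂μH ≤ N * ∫ U, Real.exp (-β * action₁ U) ∂μH := by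
    rw [← integral_const_mul]
    refine integral_mono hintSR (hintS.const_mul _) fun U => ?_
    have := reSum_le q U
    simp only
    nlinarith [Real.exp_pos (-β * action₁ U)]
  -- assemble: `Z_w ≥ e^{a₀} Z₁`
  have hkey : Real.exp a₀ * ZC β (unifC (Ls := Ls) (Lt := Lt) 1 q) ≤ ZC β (unifC (Ls := Ls) (Lt := Lt) w q) := by
    rw [hZw, hZ1]
    refine le_trans ?_ hmono
    rw [hlhs, hR, mul_zero, sub_zero]
    refine mul_le_mul_of_nonneg_left ?_ (Real.exp_nonneg _)
    have hZ1' : 0 < ∫ U, Real.exp (-β * action₁ U) ∂μH := by rw [← hZ1]; exact hZ1pos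
    have h2 : β * (1 - ((w : ℂ)).re) * (∫ U, Real.exp (-β * action₁ U) * reSum q U ∂μH) ≤
        β * (1 - ((w : ℂ)).re) * (N * ∫ U, Real.exp (-β * action₁ U) ∂μH) :=
      mul_le_mul_of_nonneg_left hRle (mul_nonneg hβ hw1)
    rw [ha₀]
    nlinarith
  have hlog := Real.log_le_log (mul_pos (Real.exp_pos _) hZ1pos) hkey
  rw [Real.log_mul (Real.exp_pos _).ne' hZ1pos.ne', Real.log_exp] at hlog
  linarith

end Jensen

/-! ### The witness -/

/-- **`AbelianCoulombWitness` (stmt-QuantumFields-26660), by name.** [problem-side] -/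
theorem abelianCoulombWitness_proof : Summit.QuantumFields.YangMills.Theses.MagneticFluxCeiling.AbelianCoulombWitness := by
  letI : MeasurableSpace Circle := borel Circle
  haveI : BorelSpace Circle := ⟨rfl⟩
  intro β hβ θ Ls Lt hLs _ q hq
  rw [twistedPartitionFunctionAniso_u1_eq_unif β θ hLs q hq, twistedPartitionFunctionAniso_u1_one_eq_unif β q]
  refine le_trans ?_ (log_ZC_unifC_sub_ge hβ (Circle.exp (θ / ((Ls : ℝ) ^ 2))) q)
  -- `1 − cos(θ/L_s²) ≤ θ²/(2L_s⁴)` and `#sites = L_s³ L_t`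
  have hLs0 : (0 : ℝ) < (Ls : ℝ) := by exact_mod_cast hLs
  have hcos : 1 - (((Circle.exp (θ / ((Ls : ℝ) ^ 2)) : Circle) : ℂ)).re ≤ (θ / ((Ls : ℝ) ^ 2)) ^ 2 / 2 := by
    rw [Circle.coe_exp, Complex.exp_ofReal_mul_I_re]
    linarith [Real.one_sub_sq_div_two_le_cos (x := θ / ((Ls : ℝ) ^ 2))]
  have hcard : (Fintype.card (FinTorusSite Ls Ls Ls Lt) : ℝ) = (Ls : ℝ) ^ 3 * (Lt : ℝ) := by
    simp [FinTorusSite, Fintype.card_prod, Fintype.card_fin]; ring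
  rw [hcard]
  have hnn : 0 ≤ β * ((Ls : ℝ) ^ 3 * (Lt : ℝ)) := by positivity
  have key : β * (1 - (((Circle.exp (θ / ((Ls : ℝ) ^ 2)) : Circle) : ℂ)).re) * ((Ls : ℝ) ^ 3 * (Lt : ℝ)) ≤
      β * θ ^ 2 / 2 * (Lt : ℝ) / (Ls : ℝ) := by
    calc β * (1 - (((Circle.exp (θ / ((Ls : ℝ) ^ 2)) : Circle) : ℂ)).re) * ((Ls : ℝ) ^ 3 * (Lt : ℝ))
        = β * ((Ls : ℝ) ^ 3 * (Lt : ℝ)) * (1 - (((Circle.exp (θ / ((Ls : ℝ) ^ 2)) : Circle) : ℂ)).re) := by ring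
      _ ≤ β * ((Ls : ℝ) ^ 3 * (Lt : ℝ)) * ((θ / ((Ls : ℝ) ^ 2)) ^ 2 / 2) := mul_le_mul_of_nonneg_left hcos hnn
      _ = β * θ ^ 2 / 2 * (Lt : ℝ) / (Ls : ℝ) := by field_simp
  have e : -(β * θ ^ 2 / 2) * (Lt : ℝ) / (Ls : ℝ) = -(β * θ ^ 2 / 2 * (Lt : ℝ) / (Ls : ℝ)) := by ring
  rw [e]
  exact neg_le_neg key


end Summit.QuantumFields.YangMills.Theorems.MagneticFluxCeiling.AbelianWitness

end
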